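import Mathlib
import HarnessLib.Audit
import Summits.PneNP.PneNP.Theorems.PstarCrossRowsAtCarrier
import Summits.PneNP.PneNP.Theorems.PstarCrossCaseTRows

/-!
# The blind free CROSS gate, regime T (node N3), the (EQ) chord with another real chord: at most ONE private tree edge (O2 / E1; prover-1 g23)

FRONTIER range-avoidance ladder, rung F-N3 (`stmt-PneNP-19007`), cell `pnp-ideate`; restricted-model proof complexity — nothing here bears on `P` versus `NP`.

Node N3 (`PstarCrossNodes.CrossCaseT`), the (EQ) sub-case `q_m = u_{e₁}` with a SECOND real chord `e₂ ≠ e₁`.  By `PstarCrossCaseTRows.caseT_eq_other`,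
`u_{e₂} + u_{e₁} = μ₁μ₂` is a non-degenerate product, and it vanishes on `{u_{e₁} = 1}` (there `u_{e₂} = 1` too, since `Z(u_{e₂}) ⊆ Z(q_m) = Z(u_{e₁})`).

* `caseT_eq_mem_D` — in the (EQ) case every private tree edge lies in `D e₁` (both constraints' rows vanish on `{u_{e₁} = 1}`:
  `PstarCrossRowsAtCarrier.untouched_of_row_at` + `PstarCrossBudget.cross_touch`);
* `caseT_eq_cross_zero` — the symmetric product of the linear parts of `μ₁μ₂` vanishes at every pair (variable of `π₁`, variable of `π₂`) of two private
  tree edges (polar forms of `Q_{D e₂} + Q_{D e₁} = μ₁μ₂` at basis vectors; a private AND variable is AND-adjacent only to its mate);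
* **`caseT_eq_two_priv_false`** — hence two private tree edges `π₁ ≠ π₂` are contradictory: both lie in `D e₁`, a third edge of `D e₁` is excluded by
  rank six (`false_of_third_edge_at`), so `D e₁ = {π₁, π₂}`; the linear parts live on `V(π₁) ∪ V(π₂)` (`factors_fixed_off_D_at`) with all cross values
  zero, so they live on one `πᵢ` (`carrier_or_corner`) — the corner, impossible (`corner_false_at`, toggling the other edge).
So the (EQ) case of N3 is reduced to: `E = {e₁}` (closed: `PstarCrossCaseTEq.crossCaseT_eq_single`) or several real chords with AT MOST ONE private
tree edge in the whole core (open; the budget then reads `#(J₀ ∖ N) + 1 ≤ #E + 2`).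
-/

set_option linter.dupNamespace false -- `Summit.PneNP.PneNP.…`: summit = sub-problem name (D-0017 single-conjunct layout)

open Finset Module Literature.Computability.Complexity
open Summit.PneNP.PneNP.Theorems.PstarTyped (Typed)
open Summit.PneNP.PneNP.Theorems.PstarSALevel (varSet BoundaryExpanding SimpleOverlap)
open Summit.PneNP.PneNP.Theorems.PstarCentreFree (vars_mem_varSet)
open Summit.PneNP.PneNP.Theorems.PstarCubeIdeals (IsAffineFn IsQuadFn)
open Summit.PneNP.PneNP.Theorems.PstarProductRank (qform polar)
open Summit.PneNP.PneNP.Theorems.PstarPathRank (AndAdj polar_basis and_ne)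
open Summit.PneNP.PneNP.Theorems.PstarReadSumset (V2)
open Summit.PneNP.PneNP.Theorems.PstarRankRigidityTwo (affine_mul_polar symForm_apply linPart_apply)
open Summit.PneNP.PneNP.Theorems.PstarChordSystem (ChordSystem)
open Summit.PneNP.PneNP.Theorems.PstarChordBridgeTools
open Summit.PneNP.PneNP.Theorems.PstarChordBridge
open Summit.PneNP.PneNP.Theorems.PstarChordBridgeForcing (freeMon gam sys_u_eq rank_four_of_wf)
open Summit.PneNP.PneNP.Theorems.PstarChordBridgeBasis (qDir polarDir)
open Summit.PneNP.PneNP.Theorems.PstarGateCasePUnitsTouch (not_mem_C_of_qDir polarDir_single)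
open Summit.PneNP.PneNP.Theorems.PstarCrossData (CrossData)
open Summit.PneNP.PneNP.Theorems.PstarCrossSystem
open Summit.PneNP.PneNP.Theorems.PstarCrossCorner (PrivEdge)
open Summit.PneNP.PneNP.Theorems.PstarCrossBudget (cross_touch)
open Summit.PneNP.PneNP.Theorems.PstarCrossCasePEmptyToggle (andAdj_priv_iff)
open Summit.PneNP.PneNP.Theorems.PstarCrossCaseU2 (u_add isQuadFn_qDir)
open Summit.PneNP.PneNP.Theorems.PstarCrossCaseU2Touch (ne_of_privEdge carrier_or_corner)
open Summit.PneNP.PneNP.Theorems.PstarCrossCaseT (forcing_of_real)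
open Summit.PneNP.PneNP.Theorems.PstarCrossCaseTRows (caseT_eq_q10 caseT_eq_other)
open Summit.PneNP.PneNP.Theorems.PstarCrossRowsAt (clean_or_nondeg_at factors_fixed_off_D_at corner_false_at)
open Summit.PneNP.PneNP.Theorems.PstarCrossRowsAtCarrier (false_of_third_edge_at untouched_of_row_at)

namespace Summit.PneNP.PneNP.Theorems.PstarCrossCaseTEqPriv

variable {n m : ℕ}

section

variable (I : LocalMap 4 n m) {r : ℕ} {B : BridgeData n m} {e_p e_q g₀ : Fin m}

/-- `q_{(1,1)} = q_{(0,1)} + q_{(1,0)}`. -/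
theorem qDir_one_one' (B : BridgeData n m) (x : Fin n → ZMod 2) : qDir I B (1, 1) x = qDir I B (0, 1) x + qDir I B (1, 0) x := by
  unfold PstarChordBridgeBasis.qDir
  simp only [one_mul, zero_mul, add_zero, zero_add]

/-- **(EQ) case: every private tree edge lies in `D e₁`.**  Both state-free parts vanish on `{u_{e₁} = 1}`, so both rows are clean or non-degenerate
products at level one, and a private tree edge outside `D e₁` would be read by neither constraint. -/
theorem caseT_eq_mem_D (hI : I.IsPure xorAndPred) (hT : Typed I) (hS : SimpleOverlap I) (hB : BoundaryExpanding r I)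
    (hD : CrossData I r B e_p e_q g₀) {mv : V2} (hmvT : mv = (0, 1) ∨ mv = (1, 1))
    (hline : ∀ e ∈ (B.N.erase e_q).erase e_p,
      (((sys I B).vsys e_p e_q).ρ e 0 = 0 ∨ ((sys I B).vsys e_p e_q).ρ e 0 = mv) ∧
      (((sys I B).vsys e_p e_q).ρ' e 0 = 0 ∨ ((sys I B).vsys e_p e_q).ρ' e 0 = mv))
    (hread : ∀ e ∈ (B.N.erase e_q).erase e_p, ((sys I B).vsys e_p e_q).ρ e 0 ≠ 0 ∨ ((sys I B).vsys e_p e_q).ρ' e 0 ≠ 0)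
    {e₁ : Fin m} (he₁ : e₁ ∈ B.N) (hq : ∀ x, qDir I B mv x = (sys I B).u e₁ x) {π : Fin m} (hπ : PrivEdge I B π) : π ∈ B.D e₁ := by
  classical
  have hW := hD.wf
  set κ₂ : ZMod 2 := 1 + ∑ e ∈ (B.N.erase e_q).erase e_p, ((((sys I B).vsys e_p e_q).ρ e 0).2 + (((sys I B).vsys e_p e_q).ρ' e 0).2) with hκ₂
  have e10 : ∀ a : ZMod 2, a = 1 → a + 1 = 0 := by decide
  have hZ10 : ∀ x, (sys I B).u e₁ x = 1 → qDir I B (1, 0) x + κ₂ = 0 := fun x hx =>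
    caseT_eq_q10 I hI hT hD hmvT hline hread hq (e10 _ hx)
  obtain ⟨κ₁, hZ01⟩ : ∃ κ₁ : ZMod 2, ∀ x, (sys I B).u e₁ x = 1 → qDir I B (0, 1) x + κ₁ = 0 := by
    rcases hmvT with rfl | rfl
    · exact ⟨1, fun x hx => by rw [hq x]; exact e10 _ hx⟩
    · refine ⟨1 + κ₂, fun x hx => ?_⟩
      have h11 := hq x
      rw [qDir_one_one'] at h11
      have h2 := hZ10 x hx
      rw [hx] at h11
      revert h11 h2
      generalize qDir I B (0, 1) x = a; generalize qDir I B (1, 0) x = b; generalize κ₂ = k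
      revert a b k; decide
  have hr10 := clean_or_nondeg_at I hI hS hB hD he₁ (isQuadFn_qDir I B (1, 0) κ₂) hZ10
  have hr01 := clean_or_nondeg_at I hI hS hB hD he₁ (isQuadFn_qDir I B (0, 1) κ₁) hZ01
  have hGfree : ∀ G : Finset (Fin m), (∀ v ∈ privs I B.N, ∀ g ∈ G, I.vars g 2 ≠ v ∧ I.vars g 3 ≠ v) →
      ∀ g ∈ G, ¬ (I.vars g 2 ∈ privs I B.N ∨ I.vars g 3 ∈ privs I B.N) := by
    intro G h g hg hor
    rcases hor with h2 | h3
    · exact (h _ h2 g hg).1 rfl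
    · exact (h _ h3 g hg).2 rfl
  have hd₁ : Disjoint B.G₁ B.J₀ := Finset.disjoint_of_subset_left (subset_insert g₀ B.G₁) hD.disj₁
  have hGf₁ := hGfree B.G₁ fun v hv => (hD.hun v hv).1
  have hGf₂ := hGfree B.G₂ fun v hv => (hD.hun v hv).2
  have hlin₁ : ∀ (π : Fin m) (s : Fin 4), π ∈ B.J₀ \ B.N → 2 ≤ s.val →
      qDir I B (0, 1) (Pi.single (I.vars π s) 1) = qDir I B (0, 1) 0 → I.vars π s ∉ B.C₁ :=
    fun π s hπ hs h => (not_mem_C_of_qDir I hI hT hW hπ hs).1 h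
  have hlin₂ : ∀ (π : Fin m) (s : Fin 4), π ∈ B.J₀ \ B.N → 2 ≤ s.val →
      qDir I B (1, 0) (Pi.single (I.vars π s) 1) = qDir I B (1, 0) 0 → I.vars π s ∉ B.C₂ :=
    fun π s hπ hs h => (not_mem_C_of_qDir I hI hT hW hπ hs).2 h
  have hpol₁ : ∀ c d : Fin n, polarDir I B (0, 1) (Pi.single c 1) (Pi.single d 1) =
      ((polar B.T₁ (fun j => I.vars j 2) (fun j => I.vars j 3) + polar (freeMon I B.N B.G₁) (fun j => I.vars j 2) (fun j => I.vars j 3) :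
        LinearMap.BilinForm (ZMod 2) (Fin n → ZMod 2)) (Pi.single c 1)) (Pi.single d 1) := fun c d => by
    rw [polarDir_single]; simp
  have hpol₂ : ∀ c d : Fin n, polarDir I B (1, 0) (Pi.single c 1) (Pi.single d 1) =
      ((polar B.T₂ (fun j => I.vars j 2) (fun j => I.vars j 3) + polar (freeMon I B.N B.G₂) (fun j => I.vars j 2) (fun j => I.vars j 3) :
        LinearMap.BilinForm (ZMod 2) (Fin n → ZMod 2)) (Pi.single c 1)) (Pi.single d 1) := fun c d => by
    rw [polarDir_single]; simp
  by_contra hπD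
  obtain ⟨hC₁, hG₁⟩ := untouched_of_row_at I hI hS hB hD he₁ (mv := (0, 1)) hW.hT₁ hd₁ hGf₁ hlin₁ hpol₁ hr01 hZ01 hπ hπD
  obtain ⟨hC₂, hG₂⟩ := untouched_of_row_at I hI hS hB hD he₁ (mv := (1, 0)) hW.hT₂ hD.disj₂ hGf₂ hlin₂ hpol₂ hr10 hZ10 hπ hπD
  exact cross_touch I hI hD hπ.1 hπ.2 hC₁ hC₂ hG₁ hG₂

/-- **The cross values of the linear parts vanish.**  If `u_{e₂} + u_{e₁} = μ₁μ₂` for chords `e₁, e₂` and `π₁ ≠ π₂` are private tree edges, then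
`λ₁(b)λ₂(a) + λ₁(a)λ₂(b) = 0` for every AND variable `a` of `π₁` and every variable `b` of `π₂` (`λᵢ(c) = μᵢ(e_c) + μᵢ(0)`). -/
theorem caseT_eq_cross_zero (hI : I.IsPure xorAndPred) (hS : SimpleOverlap I) (hD : CrossData I r B e_p e_q g₀) {e₁ e₂ : Fin m} (he₁ : e₁ ∈ B.N)
    (he₂ : e₂ ∈ B.N) {μ₁ μ₂ : (Fin n → ZMod 2) → ZMod 2} (h₁ : IsAffineFn μ₁) (h₂ : IsAffineFn μ₂)
    (hP : ∀ x, (sys I B).u e₂ x + (sys I B).u e₁ x = μ₁ x * μ₂ x) {π₁ π₂ : Fin m} (hπ₁ : PrivEdge I B π₁) (hπ₂ : PrivEdge I B π₂) (h12 : π₁ ≠ π₂)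
    {s : Fin 4} (s' : Fin 4) (hs : s = 2 ∨ s = 3) :
    (μ₁ (Pi.single (I.vars π₂ s') 1) + μ₁ 0) * (μ₂ (Pi.single (I.vars π₁ s) 1) + μ₂ 0) +
      (μ₁ (Pi.single (I.vars π₁ s) 1) + μ₁ 0) * (μ₂ (Pi.single (I.vars π₂ s') 1) + μ₂ 0) = 0 := by
  classical
  have hπ₂J : π₂ ∈ B.J₀ := (mem_sdiff.1 hπ₂.1).1
  -- polar identity: `polar(D e₂) + polar(D e₁) = symForm`
  have hpolar : ∀ x y, polar (B.D e₂) (fun j => I.vars j 2) (fun j => I.vars j 3) x y + polar (B.D e₁) (fun j => I.vars j 2) (fun j => I.vars j 3) x y =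
      (μ₁ x + μ₁ 0) * (μ₂ y + μ₂ 0) + (μ₁ y + μ₁ 0) * (μ₂ x + μ₂ 0) := by
    intro x y
    have hm := affine_mul_polar h₁ h₂ x y
    rw [symForm_apply, linPart_apply, linPart_apply, linPart_apply, linPart_apply, ← hP, ← hP, ← hP, ← hP, u_add I B e₂ x y, u_add I B e₁ x y] at hm
    have e : ∀ a2 b2 c2 P2 a1 b1 c1 P1 S : ZMod 2,
        a2 + b2 + c2 + P2 + (a1 + b1 + c1 + P1) = a2 + a1 + (b2 + b1) + (c2 + c1) + S → P2 + P1 = S := by decide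
    exact e _ _ _ _ _ _ _ _ _ hm
  -- at `(e_b, e_a)` both adjacency indicators vanish: a private AND variable is adjacent only to its mate
  obtain ⟨s'', hs''23, hss''⟩ : ∃ s'' : Fin 4, (s'' = 2 ∨ s'' = 3) ∧ s ≠ s'' := by
    rcases hs with rfl | rfl
    · exact ⟨3, Or.inr rfl, by decide⟩
    · exact ⟨2, Or.inl rfl, by decide⟩
  have hb : I.vars π₂ s' ≠ I.vars π₁ s'' := ne_of_privEdge I hπ₁ hs''23 hπ₂J (Ne.symm h12) s'
  have hzero : ∀ e ∈ B.N, polar (K := ZMod 2) (B.D e) (fun j => I.vars j 2) (fun j => I.vars j 3)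
      (Pi.single (I.vars π₂ s') 1) (Pi.single (I.vars π₁ s) 1) = 0 := by
    intro e he
    have hDJ : B.D e ⊆ B.J₀ := (hD.wf.hD e he).trans sdiff_subset
    rw [polar_basis I hI hS, if_neg]
    intro hA
    exact hb ((andAdj_priv_iff I hI hDJ hπ₁ hs hs''23 hss'' _).1 hA).2
  have h := hpolar (Pi.single (I.vars π₂ s') 1) (Pi.single (I.vars π₁ s) 1)
  rw [hzero e₂ he₂, hzero e₁ he₁, add_zero] at h
  exact h.symm

/-- **(EQ) case with a second real chord: two private tree edges are contradictory.**  See the module docstring. -/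
theorem caseT_eq_two_priv_false (hI : I.IsPure xorAndPred) (hT : Typed I) (hS : SimpleOverlap I) (hB : BoundaryExpanding r I)
    (hD : CrossData I r B e_p e_q g₀) {mv : V2} (hmvT : mv = (0, 1) ∨ mv = (1, 1))
    (hline : ∀ e ∈ (B.N.erase e_q).erase e_p,
      (((sys I B).vsys e_p e_q).ρ e 0 = 0 ∨ ((sys I B).vsys e_p e_q).ρ e 0 = mv) ∧
      (((sys I B).vsys e_p e_q).ρ' e 0 = 0 ∨ ((sys I B).vsys e_p e_q).ρ' e 0 = mv))
    (hread : ∀ e ∈ (B.N.erase e_q).erase e_p, ((sys I B).vsys e_p e_q).ρ e 0 ≠ 0 ∨ ((sys I B).vsys e_p e_q).ρ' e 0 ≠ 0)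
    {e₁ : Fin m} (he₁ : e₁ ∈ (B.N.erase e_q).erase e_p) (hq : ∀ x, qDir I B mv x = (sys I B).u e₁ x)
    {e₂ : Fin m} (he₂ : e₂ ∈ (B.N.erase e_q).erase e_p) (hne : e₂ ≠ e₁)
    {π₁ π₂ : Fin m} (hπ₁ : PrivEdge I B π₁) (hπ₂ : PrivEdge I B π₂) (h12 : π₁ ≠ π₂) : False := by
  classical
  have he₁N : e₁ ∈ B.N := mem_of_mem_erase (mem_of_mem_erase he₁)
  have he₂N : e₂ ∈ B.N := mem_of_mem_erase (mem_of_mem_erase he₂)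
  -- the second chord's product and its vanishing on `{u_{e₁} = 1}`
  obtain ⟨μ₁, μ₂, h₁, h₂, hn₁, hn₂, hn, hP⟩ := caseT_eq_other I hI hT hS hB hD hmvT hline hread he₁N hq he₂ hne
  have e01 : ∀ t : ZMod 2, t = 0 ∨ t = 1 := by decide
  have hZ : ∀ x, (sys I B).u e₁ x = 1 → μ₁ x * μ₂ x = 0 := fun x hx => by
    have hu₂ : (sys I B).u e₂ x = 1 := by
      rcases e01 ((sys I B).u e₂ x) with h0 | h1
      · have h := (forcing_of_real I hI hT hD hmvT hline hread he₂ h0).2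
        rw [hq x, hx] at h
        exact absurd h one_ne_zero
      · exact h1
    rw [← hP x, hu₂, hx]; decide
  -- both private edges lie in `D e₁`, which has no third edge
  have hπ₁D := caseT_eq_mem_D I hI hT hS hB hD hmvT hline hread he₁N hq hπ₁
  have hπ₂D := caseT_eq_mem_D I hI hT hS hB hD hmvT hline hread he₁N hq hπ₂
  have hD2 : ∀ j ∈ B.D e₁, j = π₁ ∨ j = π₂ := fun j hj => by
    by_contra hno
    push Not at hno
    exact false_of_third_edge_at I hI hS hB hD he₁N h₁ h₂ hn₁ hn₂ hn hZ hπ₁ hπ₂ h12 hπ₁D hπ₂D hj hno.1 hno.2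
  -- the linear parts vanish off `V(π₁) ∪ V(π₂)`
  have hsupp : ∀ b, b ≠ I.vars π₁ 2 → b ≠ I.vars π₁ 3 → b ≠ I.vars π₂ 2 → b ≠ I.vars π₂ 3 →
      μ₁ (Pi.single b 1) + μ₁ 0 = 0 ∧ μ₂ (Pi.single b 1) + μ₂ 0 = 0 := by
    intro b hb1 hb2 hb3 hb4
    have e : ∀ a k : ZMod 2, a = k → a + k = 0 := by decide
    obtain ⟨hμ₁, hμ₂⟩ := factors_fixed_off_D_at I hI hS hB hD he₁N h₁ h₂ hn₁ hn₂ hn hZ (z := b) fun j hj => by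
      rcases hD2 j hj with rfl | rfl
      · exact ⟨fun h => hb1 h.symm, fun h => hb2 h.symm⟩
      · exact ⟨fun h => hb3 h.symm, fun h => hb4 h.symm⟩
    exact ⟨e _ _ hμ₁, e _ _ hμ₂⟩
  have hcross := fun (s s' : Fin 4) (hs : s = 2 ∨ s = 3) =>
    caseT_eq_cross_zero I hI hS hD he₁N he₂N h₁ h₂ hP hπ₁ hπ₂ h12 s' hs
  -- either both linear parts vanish on `V(π₁)` (then they live on `V(π₂)`: corner at `π₂`), or `carrier_or_corner` at `π₁`
  by_cases hv : ∀ s : Fin 4, (s = 2 ∨ s = 3) → μ₁ (Pi.single (I.vars π₁ s) 1) + μ₁ 0 = 0 ∧ μ₂ (Pi.single (I.vars π₁ s) 1) + μ₂ 0 = 0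
  · refine corner_false_at I hI hS hD he₁N h₁ h₂ hn₁ hn₂ hn hZ hπ₂ hπ₁D h12 fun b hb3 hb4 => ?_
    by_cases hb1 : b = I.vars π₁ 2
    · rw [hb1]; exact hv 2 (Or.inl rfl)
    by_cases hb2 : b = I.vars π₁ 3
    · rw [hb2]; exact hv 3 (Or.inr rfl)
    exact hsupp b hb1 hb2 hb3 hb4
  · push Not at hv
    obtain ⟨s₀, hs₀, hns⟩ := hv
    have hv' : ¬ (μ₁ (Pi.single (I.vars π₁ s₀) 1) + μ₁ 0 = 0 ∧ μ₂ (Pi.single (I.vars π₁ s₀) 1) + μ₂ 0 = 0) := fun h => hns h.1 h.2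
    have hw₀ : I.vars π₁ s₀ = I.vars π₁ 2 ∨ I.vars π₁ s₀ = I.vars π₁ 3 := by
      rcases hs₀ with rfl | rfl
      · exact Or.inl rfl
      · exact Or.inr rfl
    rcases carrier_or_corner h₁ h₂ hn₁ hn₂ hn (v := I.vars π₁ 2) (v' := I.vars π₁ 3) hw₀ hv' with ⟨w, hw, b, hb1, hb2, hval⟩ | hcorner
    · obtain ⟨s, hs, hws⟩ : ∃ s : Fin 4, (s = 2 ∨ s = 3) ∧ w = I.vars π₁ s := by
        rcases hw with h | h
        · exact ⟨2, Or.inl rfl, h⟩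
        · exact ⟨3, Or.inr rfl, h⟩
      subst hws
      by_cases hb3 : b = I.vars π₂ 2
      · rw [hb3, hcross s 2 hs] at hval
        exact zero_ne_one hval
      by_cases hb4 : b = I.vars π₂ 3
      · rw [hb4, hcross s 3 hs] at hval
        exact zero_ne_one hval
      obtain ⟨hμ₁, hμ₂⟩ := hsupp b hb1 hb2 hb3 hb4
      rw [hμ₁, hμ₂, zero_mul, mul_zero, add_zero] at hval
      exact zero_ne_one hval
    · exact corner_false_at I hI hS hD he₁N h₁ h₂ hn₁ hn₂ hn hZ hπ₁ hπ₂D (Ne.symm h12) hcorner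

end

end Summit.PneNP.PneNP.Theorems.PstarCrossCaseTEqPriv
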